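import Summits.BirchSwinnertonDyer.BirchSwinnertonDyer.Theses.UniversalToricDescent
import Summits.BirchSwinnertonDyer.BirchSwinnertonDyer.Theorems.UniversalToricDescentThinCombDefs
import Summits.BirchSwinnertonDyer.BirchSwinnertonDyer.Theorems.UniversalToricDescentThinCombWeakReflection
import Summits.BirchSwinnertonDyer.BirchSwinnertonDyer.Theorems.UniversalToricDescentAdditiveSplitIMCInclusionAtThreeStubCharIdealPrincipal
import Summits.BirchSwinnertonDyer.BirchSwinnertonDyer.Theorems.UniversalToricDescentAdditiveSplitIMCInclusionAtThreeStubFrame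
import Summits.BirchSwinnertonDyer.BirchSwinnertonDyer.Theorems.UniversalToricDescentToricTransportModThreeNormProfile
import Summits.BirchSwinnertonDyer.BirchSwinnertonDyer.Theorems.SignedBaseChangeAnticyclotomicEisensteinDivisibilityXGrTwoModuleFinite
import Summits.BirchSwinnertonDyer.Rank1Residual.X2.HidaLimitCongruenceAlgebra
import Literature.NumberTheory.EllipticCurves.TwoVariableSelmerDual
import Literature.NumberTheory.EllipticCurves.ZpExtensionSplitPrimeLineThroughPair
import HarnessLib

/-!
# Line `ratwall_thin_comb` — the RATIONAL thin comb on the PARENT node `ToricTransportModThree`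
# (stmt-BirchSwinnertonDyer-20186, UTD r2 split node; pen bsd-wall-pss3x g7, 2026-08-29)
# v2 (LEAD bsd-wall-utd-p1 g19, 2026-08-29 — the REGISTERED shape): pen's v1 (437f67b3dc6d) with ONE reshape and one import.

v2 CHANGES vs the pen's v1 (6 stubs): (a) `stub_frame` is no longer a stub — it is the LANDED tree theorem
`…Theorems.UniversalToricDescentThinCombLine.stub_frame` (identical statement, file `…AdditiveSplitIMCInclusionAtThreeStubFrame`),
used BY NAME in `_of`; (b) `stub_ratDescent` takes the no-pseudo-null input S3n′ `(∀ N pseudo-null, Finite N)` as a hypothesis and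
a new stub `stub_noPseudoNull` (VERBATIM the registered `stub_noPseudoNull` of line `thin_comb` v3/v4 on the child 20395, shared)
supplies it — the SAME reshape the 20395 lead made v2 → v3 (05:30:51Z): v1's bare `stub_ratDescent` silently contains S3n′
(witness `L₂ := G`, `L := φ_k G`, `a = t = s = 0`: its conclusion `∃ k', 3^{k'}·φ_k G ∈ ch_Λ(X_ac)·R₀⟦T⟧` says the `f_k`-torsion of
the maximal pseudo-null submodule of `X₂` has Λ-characteristic ideal dividing a power of `3`, which `Λ₂/(T₁,T₂) ↪ X₂` would violate —
rational slack absorbs powers of `3`, not `(T)`). Stubs (6): `stub_ratCombSupply` (research XL) · `stub_noPseudoNull` (L, print; in tree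
closed modulo Greenberg 2016 Prop. 4.1.1 + Tate's global Euler characteristic) · `stub_ratDescent` (L; corollary of the LANDED
`…ThinCombLine.stub_descent` with `L₂ ↦ 3^{a+t}·L₂`, `L ↦ 3^{a+s}·L`) · `stub_ratSqueeze` (M, pure algebra) · `stub_invariantsTransport` /
`stub_twinMuZero` (route items 20399 / 20400 BY NAME). `ToricTransportModThree_of` unchanged otherwise.

Crux workfile `Cruxes/ToricTransportModThree/Lines/ratwall_thin_comb.lean`. NOT registered by the pen (registration =
the 20186 lead's single slot); offered to director-bsd / the utd-p1 and cruxlead-20395 lineages as the typed form of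
the «RatWall twin» asked for in `Cruxes/AdditiveSplitIMCInclusionAtThree/PICKED.md` (cruxlead-20395 g2, staffing (ii))
and foreseen in the card `thin-comb-reflection` §(f) / the lead's `Lines/thin_comb_doors.lean` (`ratWall_of_package`,
SOFT there: `G`, `πac` unpinned). Here everything is PINNED exactly as in the registered integral line `thin_comb` v2
(`Cruxes/AdditiveSplitIMCInclusionAtThree/Lines/thin_comb.lean`, sha16 76d3467012f0f2fc).

## Thesis of the line (why the parent, and what is gained)

The integral WALL `AdditiveSplitIMCInclusionAtThree` (20395) asks for `(L) ⊆ Ch·R₀⟦T⟧` with NO 3-power slack, and on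
the integral line the slack-freeness is one of the three unprinted inputs of the research stub (lead's census: «slack-free
Λ-adic Kolyvagin bound at p = 3»). But the route consumes the wall only through the parent glue
`ToricTransportModThreeOfWallPieces : AdditiveSplitIMCInclusionAtThree → InvariantsTransportModThree → TwinMuZeroAtThree →
ToricTransportModThree` (20401, proved), and `InvariantsTransportModThree` (20399-type sibling, fed by the twin's
`μ = 0` = `TwinMuZeroAtThree` 20400) hands over a generator `g` of `Ch·R₀⟦T⟧` WITH A COEFFICIENT OF NORM ONE
(`‖g_n‖ = 1`, i.e. `μ(g) = 0`). A `μ = 0` generator is coprime to `3` in the UFD `R₀⟦T⟧`, so the RATIONAL wall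
`∃ k, 3^k·L ∈ Ch·R₀⟦T⟧` already gives `g ∣ L` and then `(g) = (L)` by the landed norm-profile squeeze
(`UniversalToricDescentNormProfile.span_eq_span_of_dvd_of_normProfile`). Hence on the PARENT the thin comb may be run
in its RATIONAL currency throughout — `ThinCombDvdRat` (slack `3^{t_m}` per level), the tree's RATIONAL rigidity
`UniversalToricDescentThinComb.dvd_pow_mul_of_weakReflection` (lead, p693012, used BY NAME below — not a stub), a rational
comparison `3^t·L₂ ≡ u·3^s·L(T₁) (mod 𝔞_k)` and a rational control — and the integral slack is PAID BY THE TWIN's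
`μ = 0`, an input the route needs anyway. Net effect relative to `thin_comb` v2: the research stub drops «slack-free»
(one of its three unprinted inputs); the other two (𝛉-dominant Beilinson–Flach reciprocity at the supercuspidal `f_E`;
the toric two-variable `L₂` at `3 ∣ N` with its functional equation) remain, verbatim in rational dress.

## Stubs (6) and composition

`stub_frame` (= v2's, support M) · `stub_ratCombSupply` (research XL: v2's `stub_twoVarCombSupply` with `ThinCombDvdRat`
and two-sided `3`-power slack in the comparison) · `stub_ratDescent` (L: v2's `stub_descent` in rational form, output
`∃ k', 3^{k'}·L ∈ Ch·R₀⟦T⟧`) · `stub_ratSqueeze` (M, pure algebra in `R₀⟦T⟧`: `I = (g)`, `‖g_i‖ < 1 (i < n)`,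
`‖g_n‖ = 1 = ‖L_n‖`, `3^k·L ∈ I` ⟹ `I = (L)`) · `stub_invariantsTransport` / `stub_twinMuZero` (the sibling route items
`InvariantsTransportModThree` / `TwinMuZeroAtThree` BY NAME — they close when those items close; listed as stubs only
because `_of` must be stated over registered antecedents). `ToricTransportModThree_of` is kernel-checked (no `sorry`
outside the stubs) and concludes the parent decl BY NAME; v2's `stub_charIdealPrincipal` (LANDED p692284) and the rational
rigidity are used as tree theorems, not stubs.

HONESTY. (1) Nothing here is evidence that the rational package EXISTS at an additive split 3 — `stub_ratCombSupply` is
research-grade exactly like v2's research stub minus integrality. (2) The line decides the PARENT, not the wall: if it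
closes, 20186 closes without 20395 (a split node stays claimable for a direct proof). (3) `stub_frame` is the v2
statement verbatim (true in all cases: THIN-COMB-V2-NOTE §2(b); pen's check in `Lines/thin_comb.md` rev 3). (4) The
two-sided slack `(t, s)` in the comparison is deliberate (period normalisations of the toric `L₂` vs the BDP frame may
differ by powers of 3 at an additive prime). BSD is not proved by any of this; 20186 and 20395 OPEN.
-/

set_option linter.dupNamespace false
set_option autoImplicit false

noncomputable section

open NumberField IsDedekindDomain Field
open Literature.NumberTheory.EllipticCurves
open Summit.BirchSwinnertonDyer.BirchSwinnertonDyer.Theorems.UniversalToricDescentThinComb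

namespace Summit.BirchSwinnertonDyer.BirchSwinnertonDyer.Cruxes.ToricTransportModThree.RatwallThinComb

/-- **stub_ratCombSupply** (THE research stub, crux-sized XL; = v2's `stub_twoVarCombSupply` in RATIONAL currency):
for every BDP frame `L` of `f_E` and the PINNED generator `g` of `ch_{Λ₂}(X₂)` in a v2 frame: `X₂` is `Λ₂`-torsion, and
there are a WEAK reflection `ρ` (fixes constants, `ρ T₂ ∉ (3, T₂)`) and `L₂ ∈ Λ₂(R₀)` with `ρ G ∼ G` (K4, in print:
Nekovář 2006), `ρ L₂ ∼ L₂` (K3(iii)), the RATIONAL comparison `3^t·L₂ ≡ u·3^s·L(T₁) (mod 𝔞_k)` (K3(ii) up to a power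
of 3) and RATIONAL comb divisibility `ThinCombDvdRat R₀ 3 G L₂` (K2: `G ∣ 3^{t_m}·L₂ (mod E_m(T₂))` on levels of
unbounded order — what one Euler-system argument per 3-power twist delivers, slack allowed). Why it might fail: as v2's
research stub (no reciprocity law for Beilinson–Flach classes at a supercuspidal `p ∣ N` in print; no typed toric
two-variable `L₂` at `3 ∣ N`); the integrality input is GONE. -/
theorem stub_ratCombSupply :
    ∀ (W : WeierstrassCurve ℚ) [W.IsElliptic] [W.IsGloballyMinimal] (N : ℕ) [NeZero N] (K : Type) [Field K]
      [NumberField K] (Dt : Literature.NumberTheory.EllipticCurves.ModularForms.ModularParametrizationData W N),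
    Summit.BirchSwinnertonDyer.Rank1Residual.Additive.ClassO6 W 3 → W.HasSurjectiveModNGaloisRep 3 →
    W.analyticRank = 1 → W.conductorNorm ℤ = N → IsImaginaryQuadratic K → SatisfiesHeegnerHypothesis N K →
    ∀ (κ : ZpExtension K 3), κ.IsAnticyclotomic → ∀ (γ : Field.absoluteGaloisGroup K) [Fact (κ.IsTopGenerator γ)]
      (𝔭 : HeightOneSpectrum (𝓞 K)), ((3 : ℕ) : 𝓞 K) ∈ 𝔭.asIdeal →
      𝔭.asIdeal.ramificationIdx (𝓞 ℚ) = 1 → 𝔭.asIdeal.inertiaDeg (𝓞 ℚ) = 1 →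
    ∀ (𝔭' : HeightOneSpectrum (𝓞 K)), ((3 : ℕ) : 𝓞 K) ∈ 𝔭'.asIdeal → 𝔭' ≠ 𝔭 →
    ∀ (ι' : PadicAlgCl 3 ≃+* ℂ), Summit.BirchSwinnertonDyer.BirchSwinnertonDyer.Theorems.SchneiderFree.BranchInducesPrime 3 ι' 𝔭 →
    ∀ (κ₁ κ₂ : ZpExtension K 3) (γ₁ γ₂ : Field.absoluteGaloisGroup K) (k : ℕ)
      [Fact (ZpExtension.IsTopGeneratorPair κ₁ κ₂ γ₁ γ₂)],
    (∀ v : HeightOneSpectrum (𝓞 K), v ≠ 𝔭 → ∀ 𝔓 ∈ v.primesAbove,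
        𝔓.inertia (Field.absoluteGaloisGroup K) ≤ κ₁.kerSubgroup) →
    ZpExtension.pairKer κ₁ κ₂ ≤ κ.kerSubgroup → γ₁ * γ⁻¹ ∈ κ.kerSubgroup → γ₂ * (γ ^ (3 ^ k))⁻¹ ∈ κ.kerSubgroup →
    ∀ (g : IwasawaAlgebra₂ 3),
      Literature.NumberTheory.EllipticCurves.Module.charIdeal (IwasawaAlgebra₂ 3)
        ((W.baseChange K).XGr₂ 3 κ₁ κ₂ 𝔭' γ₁ γ₂) = Ideal.span {g} →
    ∀ (ΩK : ℂ) (Ωp : ℂ_[3]) (L : UnrSeries 3), ΩK ≠ 0 → Ωp ≠ 0 →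
      IsBDPLFunction ι' 𝔭 κ γ Dt.f ΩK Ωp L →
    Module.IsTorsion (IwasawaAlgebra₂ 3) ((W.baseChange K).XGr₂ 3 κ₁ κ₂ 𝔭' γ₁ γ₂) ∧
    ∃ (ρ : PowerSeries (PowerSeries (unrIntegers 3)) ≃+* PowerSeries (PowerSeries (unrIntegers 3)))
      (L₂ : PowerSeries (PowerSeries (unrIntegers 3))),
      (∀ c : unrIntegers 3, ρ (const (unrIntegers 3) c) = const (unrIntegers 3) c) ∧
      ρ (T₂ (unrIntegers 3)) ∉ Ideal.span {const (unrIntegers 3) ((3 : ℕ) : unrIntegers 3), T₂ (unrIntegers 3)} ∧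
      Associated (ρ (PowerSeries.map (PowerSeries.map
        (Summit.BirchSwinnertonDyer.Rank1Residual.X11b.Halves.toUnr 3)) g))
        (PowerSeries.map (PowerSeries.map (Summit.BirchSwinnertonDyer.Rank1Residual.X11b.Halves.toUnr 3)) g) ∧
      Associated (ρ L₂) L₂ ∧
      (∃ (u : (PowerSeries (PowerSeries (unrIntegers 3)))ˣ) (t s : ℕ),
        const (unrIntegers 3) (((3 : ℕ) : unrIntegers 3) ^ t) * L₂ -
          u * const (unrIntegers 3) (((3 : ℕ) : unrIntegers 3) ^ s) *
            PowerSeries.map (PowerSeries.C (R := unrIntegers 3)) L ∈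
          Ideal.span {T₂ (unrIntegers 3) - ((1 + T₁ (unrIntegers 3)) ^ (3 ^ k) - 1)}) ∧
      ThinCombDvdRat (unrIntegers 3) 3
        (PowerSeries.map (PowerSeries.map (Summit.BirchSwinnertonDyer.Rank1Residual.X11b.Halves.toUnr 3)) g) L₂ := by
  sorry

/-- **stub_noPseudoNull** (support, L, PRINT; VERBATIM the registered `stub_noPseudoNull` of line `thin_comb` v3/v4 on the
child 20395 — shared, closes together): every pseudo-null `Λ₂`-submodule of the torsion `X₂ = XGr₂ (E/K) 3 κ₁ κ₂ 𝔭′ γ₁ γ₂` is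
finite. In tree CLOSED MODULO two published named facts (`…ThinComb.DescentNoPseudoNullOfFacts.stub_noPseudoNull_of_prop411_of_tateTC`:
Greenberg 2016 Prop. 4.1.1, Tate's global Euler characteristic at totally complex fields). -/
theorem stub_noPseudoNull :
    ∀ (W : WeierstrassCurve ℚ) [W.IsElliptic] [W.IsGloballyMinimal] (K : Type) [Field K] [NumberField K],
    Summit.BirchSwinnertonDyer.Rank1Residual.Additive.ClassO6 W 3 → W.HasSurjectiveModNGaloisRep 3 →
    IsImaginaryQuadratic K →
    ∀ (κ : ZpExtension K 3), κ.IsAnticyclotomic → ∀ (γ : Field.absoluteGaloisGroup K) [Fact (κ.IsTopGenerator γ)]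
      (𝔭 : HeightOneSpectrum (𝓞 K)), ((3 : ℕ) : 𝓞 K) ∈ 𝔭.asIdeal →
    ∀ (𝔭' : HeightOneSpectrum (𝓞 K)), ((3 : ℕ) : 𝓞 K) ∈ 𝔭'.asIdeal → 𝔭' ≠ 𝔭 →
    ∀ (κ₁ κ₂ : ZpExtension K 3) (γ₁ γ₂ : Field.absoluteGaloisGroup K) (k : ℕ)
      [Fact (ZpExtension.IsTopGeneratorPair κ₁ κ₂ γ₁ γ₂)],
    (∀ v : HeightOneSpectrum (𝓞 K), v ≠ 𝔭 → ∀ 𝔓 ∈ v.primesAbove,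
        𝔓.inertia (Field.absoluteGaloisGroup K) ≤ κ₁.kerSubgroup) →
    ZpExtension.pairKer κ₁ κ₂ ≤ κ.kerSubgroup → γ₁ * γ⁻¹ ∈ κ.kerSubgroup → γ₂ * (γ ^ (3 ^ k))⁻¹ ∈ κ.kerSubgroup →
    Module.Finite (IwasawaAlgebra₂ 3) ((W.baseChange K).XGr₂ 3 κ₁ κ₂ 𝔭' γ₁ γ₂) →
    Module.IsTorsion (IwasawaAlgebra₂ 3) ((W.baseChange K).XGr₂ 3 κ₁ κ₂ 𝔭' γ₁ γ₂) →
    ∀ N : Submodule (IwasawaAlgebra₂ 3) ((W.baseChange K).XGr₂ 3 κ₁ κ₂ 𝔭' γ₁ γ₂),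
      Literature.NumberTheory.EllipticCurves.Module.IsPseudoNull (IwasawaAlgebra₂ 3) N → Finite N := by
  sorry

/-- **stub_ratDescent** (support/glue, L; v2 of this line = thin_comb v3's `stub_descent` in rational form, WITH the
no-pseudo-null input S3n′ `(∀ N pseudo-null, Finite N)` as a hypothesis — exactly as the 20395 lead reshaped v2 → v3
(cruxlead-20395 g3, 05:30:51Z: the bare implication silently contains S3n′; witness `L₂ := G`, `L := φ_k G`, `a = t = s = 0`): in a v2 frame, with `X₂` f.g.
torsion and `ch X₂ = (g)`: `G ∣ 3^a·L₂` and `3^t·L₂ ≡ u·3^s·L(T₁) (mod 𝔞_k)` give the RATIONAL wall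
`∃ k', 3^{k'}·L ∈ Ch_Λ(X_ac)·R₀⟦T⟧`. Inputs as v2 (`Λ₂(R₀)/𝔞_k ≅ R₀⟦T⟧`, control `XGr₂ ⧸ 𝔞_k ↠ XAc` along
`T₁ ↦ T, 1+T₂ ↦ (1+T)^{3^k}`, no non-zero pseudo-null submodule [Greenberg 2016 Prop 4.1.1], Herbrand along `𝔞_k`
[Delbourgo 2008 Lemma 10.5], multiplicativity of `ch`); the output may absorb any finite 3-power index, so the control
step needs only a RATIONAL control theorem. -/
theorem stub_ratDescent :
    ∀ (W : WeierstrassCurve ℚ) [W.IsElliptic] [W.IsGloballyMinimal] (K : Type) [Field K] [NumberField K],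
    Summit.BirchSwinnertonDyer.Rank1Residual.Additive.ClassO6 W 3 → W.HasSurjectiveModNGaloisRep 3 →
    IsImaginaryQuadratic K →
    ∀ (κ : ZpExtension K 3), κ.IsAnticyclotomic → ∀ (γ : Field.absoluteGaloisGroup K) [Fact (κ.IsTopGenerator γ)]
      (𝔭 : HeightOneSpectrum (𝓞 K)), ((3 : ℕ) : 𝓞 K) ∈ 𝔭.asIdeal →
    ∀ (𝔭' : HeightOneSpectrum (𝓞 K)), ((3 : ℕ) : 𝓞 K) ∈ 𝔭'.asIdeal → 𝔭' ≠ 𝔭 →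
    ∀ (κ₁ κ₂ : ZpExtension K 3) (γ₁ γ₂ : Field.absoluteGaloisGroup K) (k : ℕ)
      [Fact (ZpExtension.IsTopGeneratorPair κ₁ κ₂ γ₁ γ₂)],
    (∀ v : HeightOneSpectrum (𝓞 K), v ≠ 𝔭 → ∀ 𝔓 ∈ v.primesAbove,
        𝔓.inertia (Field.absoluteGaloisGroup K) ≤ κ₁.kerSubgroup) →
    ZpExtension.pairKer κ₁ κ₂ ≤ κ.kerSubgroup → γ₁ * γ⁻¹ ∈ κ.kerSubgroup → γ₂ * (γ ^ (3 ^ k))⁻¹ ∈ κ.kerSubgroup →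
    Module.Finite (IwasawaAlgebra₂ 3) ((W.baseChange K).XGr₂ 3 κ₁ κ₂ 𝔭' γ₁ γ₂) →
    Module.IsTorsion (IwasawaAlgebra₂ 3) ((W.baseChange K).XGr₂ 3 κ₁ κ₂ 𝔭' γ₁ γ₂) →
    (∀ N : Submodule (IwasawaAlgebra₂ 3) ((W.baseChange K).XGr₂ 3 κ₁ κ₂ 𝔭' γ₁ γ₂),
      Literature.NumberTheory.EllipticCurves.Module.IsPseudoNull (IwasawaAlgebra₂ 3) N → Finite N) →
    ∀ (g : IwasawaAlgebra₂ 3),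
      Literature.NumberTheory.EllipticCurves.Module.charIdeal (IwasawaAlgebra₂ 3)
        ((W.baseChange K).XGr₂ 3 κ₁ κ₂ 𝔭' γ₁ γ₂) = Ideal.span {g} →
    ∀ (L₂ : PowerSeries (PowerSeries (unrIntegers 3))) (L : UnrSeries 3) (a : ℕ),
      PowerSeries.map (PowerSeries.map (Summit.BirchSwinnertonDyer.Rank1Residual.X11b.Halves.toUnr 3)) g ∣
        const (unrIntegers 3) (((3 : ℕ) : unrIntegers 3) ^ a) * L₂ →
      (∃ (u : (PowerSeries (PowerSeries (unrIntegers 3)))ˣ) (t s : ℕ),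
        const (unrIntegers 3) (((3 : ℕ) : unrIntegers 3) ^ t) * L₂ -
          u * const (unrIntegers 3) (((3 : ℕ) : unrIntegers 3) ^ s) *
            PowerSeries.map (PowerSeries.C (R := unrIntegers 3)) L ∈
          Ideal.span {T₂ (unrIntegers 3) - ((1 + T₁ (unrIntegers 3)) ^ (3 ^ k) - 1)}) →
      ∃ k' : ℕ, ((3 : ℕ) : UnrSeries 3) ^ k' * L ∈
        (Summit.BirchSwinnertonDyer.Rank1Residual.X11b.AcSelmer.XAc.charIdeal (W.baseChange K) 3 κ 𝔭' ∅ γ).map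
          (PowerSeries.map (Summit.BirchSwinnertonDyer.Rank1Residual.X11b.Halves.toUnr 3)) := by
  sorry

/-- **stub_ratSqueeze** (support, M; pure algebra in `R₀⟦T⟧`, folklore [Washington1997 §7.1]): if `I = (g)` with
`‖g_i‖ < 1` for `i < n` and `‖g_n‖ = 1` (so `μ(g) = 0`: `g` is coprime to the prime `3` of the UFD `R₀⟦T⟧`), `‖L_n‖ = 1`,
and `3^k·L ∈ I`, then `I = (L)`: from `g ∣ 3^k L` and `3 ∤ g` get `g ∣ L`, then the landed
`UniversalToricDescentNormProfile.span_eq_span_of_dvd_of_normProfile`. -/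
theorem stub_ratSqueeze :
    ∀ (I : Ideal (UnrSeries 3)) (g L : UnrSeries 3) (n k : ℕ), I = Ideal.span {g} →
      (∀ i < n, ‖((PowerSeries.coeff i g : unrIntegers 3) : ℂ_[3])‖ < 1) →
      ‖((PowerSeries.coeff n g : unrIntegers 3) : ℂ_[3])‖ = 1 →
      ‖((PowerSeries.coeff n L : unrIntegers 3) : ℂ_[3])‖ = 1 →
      ((3 : ℕ) : UnrSeries 3) ^ k * L ∈ I → I = Ideal.span {L} := by
  sorry

/-- **stub_invariantsTransport** — the sibling route item `InvariantsTransportModThree` BY NAME (Greenberg–Vatsal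
`(μ, λ)`-transport under `E′[3] ≅ E[3]`; closes when that item closes). -/
theorem stub_invariantsTransport :
    Summit.BirchSwinnertonDyer.BirchSwinnertonDyer.Theses.UniversalToricDescent.InvariantsTransportModThree := by
  sorry

/-- **stub_twinMuZero** — the sibling route item `TwinMuZeroAtThree` (stmt-BirchSwinnertonDyer-20400) BY NAME (`μ = 0` for
the twin's BDP frames; closes when that item closes). -/
theorem stub_twinMuZero :
    Summit.BirchSwinnertonDyer.BirchSwinnertonDyer.Theses.UniversalToricDescent.TwinMuZeroAtThree := by
  sorry

/-- **Composition** (kernel-checked, no `sorry` outside the stubs): the six stubs give the PARENT `ToricTransportModThree`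
BY NAME — rational comb + rational rigidity (tree, by name) + rational descent give `3^{k'}·L ∈ Ch·R₀⟦T⟧`; the twin's
`μ = 0` through `InvariantsTransportModThree` gives a generator `g` with `‖g_n‖ = 1 = ‖L_n‖`; the squeeze gives
`Ch·R₀⟦T⟧ = (L)`. -/
theorem ToricTransportModThree_of :
    Summit.BirchSwinnertonDyer.BirchSwinnertonDyer.Theses.UniversalToricDescent.ToricTransportModThree := by
  intro W _ _ W' _ _ N N' _ _ K _ _ Dt Dt' hO6 hsurj hrk hN hcong haddv hN' hK hH hH' κ hκ γ hγ 𝔭 h3 hram hdeg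
    𝔭' h3' hne ι' hι hex heq' ΩK Ωp L hΩK hΩp hL
  have hμ' := stub_twinMuZero W W' N N' K Dt Dt' hO6 hsurj hrk hN hcong haddv hN' hK hH hH' κ hκ γ 𝔭 h3 hram hdeg
    𝔭' h3' hne ι' hι
  obtain ⟨g, n, hI, hg, hgn, -, hLn⟩ := stub_invariantsTransport W W' N N' K Dt Dt' hO6 hsurj hrk hN hcong haddv hN'
    hK hH hH' κ hκ γ 𝔭 h3 hram hdeg 𝔭' h3' hne ι' hι hex heq' hμ' ΩK Ωp L hΩK hΩp hL
  obtain ⟨κ₁, κ₂, γ₁, γ₂, k, hpair, hur₁, hker, hγ₁, hγ₂⟩ :=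
    Summit.BirchSwinnertonDyer.BirchSwinnertonDyer.Theorems.UniversalToricDescentThinCombLine.stub_frame
      K hK κ hκ γ hγ.out 𝔭 h3 𝔭' h3' hne
  haveI : Fact (ZpExtension.IsTopGeneratorPair κ₁ κ₂ γ₁ γ₂) := ⟨hpair⟩
  obtain ⟨g₂, hg₂⟩ :=
    Summit.BirchSwinnertonDyer.BirchSwinnertonDyer.Theorems.UniversalToricDescentThinCombLine.stub_charIdealPrincipal
      ((W.baseChange K).XGr₂ 3 κ₁ κ₂ 𝔭' γ₁ γ₂)
  have hg₂' : Literature.NumberTheory.EllipticCurves.Module.charIdeal (IwasawaAlgebra₂ 3)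
      ((W.baseChange K).XGr₂ 3 κ₁ κ₂ 𝔭' γ₁ γ₂) = Ideal.span {g₂} := by
    simpa [Ideal.submodule_span_eq] using hg₂
  have hfin : Module.Finite (IwasawaAlgebra₂ 3) ((W.baseChange K).XGr₂ 3 κ₁ κ₂ 𝔭' γ₁ γ₂) :=
    Summit.BirchSwinnertonDyer.BirchSwinnertonDyer.Theorems.SignedBaseChangeAcDivFinitePiece.xGr₂_module_finite
      (W.baseChange K) 3 κ₁ κ₂ 𝔭'
  obtain ⟨htors, ρ, L₂, hρc, hρT, hGsym, hLsym, hcmp, hcomb⟩ :=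
    stub_ratCombSupply W N K Dt hO6 hsurj hrk hN hK hH κ hκ γ 𝔭 h3 hram hdeg 𝔭' h3' hne ι' hι κ₁ κ₂ γ₁ γ₂ k
      hur₁ hker hγ₁ hγ₂ g₂ hg₂' ΩK Ωp L hΩK hΩp hL
  haveI := Summit.BirchSwinnertonDyer.Rank1Residual.X2.HidaLimitAlgebra.isDiscreteValuationRing_unrIntegers (p := 3)
  have hmax : IsLocalRing.maximalIdeal (unrIntegers 3) = Ideal.span {((3 : ℕ) : unrIntegers 3)} :=
    (IsDiscreteValuationRing.irreducible_iff_uniformizer _).mp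
      Summit.BirchSwinnertonDyer.Rank1Residual.X2.HidaLimitAlgebra.irreducible_natCast_p
  obtain ⟨a, hdvd⟩ := dvd_pow_mul_of_weakReflection (unrIntegers 3) 3 hmax ρ hρc hρT _ L₂ hGsym hLsym hcomb
  have hPN := stub_noPseudoNull W K hO6 hsurj hK κ hκ γ 𝔭 h3 𝔭' h3' hne κ₁ κ₂ γ₁ γ₂ k hur₁ hker hγ₁ hγ₂ hfin htors
  obtain ⟨k', hk'⟩ := stub_ratDescent W K hO6 hsurj hK κ hκ γ 𝔭 h3 𝔭' h3' hne κ₁ κ₂ γ₁ γ₂ k hur₁ hker hγ₁ hγ₂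
    hfin htors hPN g₂ hg₂' L₂ L a hdvd hcmp
  exact stub_ratSqueeze _ g L n k' hI hg hgn hLn hk'

end Summit.BirchSwinnertonDyer.BirchSwinnertonDyer.Cruxes.ToricTransportModThree.RatwallThinComb

end
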